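import Summits.HodgeConjecture.HodgeConjecture.Theorems.WeilTypeLadderSixfoldSlices
import Summits.HodgeConjecture.HodgeConjecture.Theorems.Ring2AbelianAllWeilCellsAnchored
import Summits.HodgeConjecture.HodgeConjecture.Theorems.Ring2HypothesesWeilDiscriminantHolds
import Summits.HodgeConjecture.HodgeConjecture.Theorems.Ring2HypothesesWeilComponentsSplit
import Summits.HodgeConjecture.HodgeConjecture.Theorems.Ring2AbelianAllWeilSignCells
import Summits.HodgeConjecture.HodgeConjecture.Theorems.Ring2AbelianAllWeilAnchorCellsOnPath
import Summits.HodgeConjecture.HodgeConjecture.Theses.SplitImpliesAll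

/-! # Line `similar-germ-anchors` on crux `SplitImpliesAll.NonsplitSixfoldCells` — the DIMENSION-SIX germ road
(DOOR B′ of `WeilTypeLadderSixfoldSlices`, cell language).

Idea: stay in dimension six. Deligne's polarized Weil family through an ANCHOR `(P, ψ₀, h_P, w)` reaches every
Weil-similar target up to `K`-isogeny (`weilFamilyReach_similar`, IN PRINT: Deligne 1982 proof of Thm. 4.8 +
Landherr); if at ONE anchor per Weil-similarity class away from the split class the Weil class `w` satisfies the
LOCAL CLAUSE (variational Hodge AS A GERM at the anchor: `WeilAnchorLocalClause 3 d P h_P w` — the output shape of a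
semiregularity theorem, asserted for no representative in print), the countable-union locus lemma spreads
algebraicity over the whole family and isogeny invariance lands it on the target
(`weilClassesOf_le_algebraicClasses_of_reachSimilar_of_similarAnchor`, PROVED in the tree). Targets with a
hyperbolic `K`-symmetrised hyperplane class go to the split floor (the route's residual `SplitSixfoldCells`,
fact-free into `Markman2025_weilClasses_algebraic_hyperbolicSixfold` by `hyperbolicSixfolds_of_split_components_holds`).
All sixfolds at every `d` ⟹ the crux (on-path). The load-bearing stub is `stub_similarGermAnchors` = «the single
extra germ statement that extends the printed reach to all Weil type of dimension 6» (seat P3's brief).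

Imports the born route file `Theses/SplitImpliesAll.lean`; concludes the crux BY NAME. -/

set_option linter.dupNamespace false

namespace Summit.HodgeConjecture.HodgeConjecture.Cruxes.NonsplitSixfoldCells.SimilarGermAnchors

open Summit.HodgeConjecture.HodgeConjecture.Theses.SplitImpliesAll

/-- stub (the route's RESIDUAL item `SplitSixfoldCells`, Markman 2025 Thm. 1.5.1 unrefereed; refereed at d = 1, 3):
the split sixfold cells — needed for the targets that carry SOME hyperbolic `K`-symmetrised hyperplane class. -/
theorem stub_splitFloor : Summit.HodgeConjecture.HodgeConjecture.Theses.SplitImpliesAll.SplitSixfoldCells := by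
  sorry

/-- stub (IN PRINT, unformalised: Deligne 1982 proof of Thm. 4.8 (LNM 900 pp. 55–60 = article pp. 47–52) with
Prop. 4.4 / Lemma 4.6, Landherr's Satz =
the tree's `hermitianMatrices_congruent_iff_invariants`, van Geemen 5.2–5.5 / 5.8–5.11): the polarized `√-d`-Weil
family through an anchor reaches every Weil-similar target of type `(n, n)` up to `K`-isogeny. -/
theorem stub_reachSimilar : Literature.AlgebraicGeometry.HodgeTheory.weilFamilyReach_similar := by
  sorry

/-- stub (THE GERM STATEMENT — research input, hardest): for every `d ≥ 1`, every NON-hyperbolic `√-d`-Weil sixfold of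
Weil type `(3,3)` has a Weil-similar anchor `(P, ψ₀, h_P, w)` at which the local clause holds (variational Hodge as
a germ at `P` along every `√-d`-Weil family through it). Intended anchors: the 6-dimensional type-II locus `𝔔(D₆)` of
the `(ℚ(√-3), 6, [-2])`-type cells (Weil classes algebraic there fact-free), products `X × S` (Schoen 1998 Addendum Prop. 10, p. 332),
the Tate anchors `E₀³ × E₀³`. Not in print for any anchor away from the split class. -/
theorem stub_similarGermAnchors :
    ∀ d : ℕ, 0 < d → Literature.AlgebraicGeometry.HodgeTheory.HasSimilarLocallyAlgebraicWeilAnchorsAwayFromSplit 3 d := by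
  sorry

/-- Composition (no sorry): floor ∧ reach ∧ germ anchors ⟹ all `√-d`-sixfolds for every `d` (DOOR B′[d]) ⟹ the
leaf `WeilSixfolds` ⟹ every cell ⟹ the variational instance on every non-split cell (on-path). -/
theorem NonsplitSixfoldCells_of
    (h₁ : Summit.HodgeConjecture.HodgeConjecture.Theses.SplitImpliesAll.SplitSixfoldCells)
    (h₂ : Literature.AlgebraicGeometry.HodgeTheory.weilFamilyReach_similar)
    (h₃ : ∀ d : ℕ, 0 < d →
      Literature.AlgebraicGeometry.HodgeTheory.HasSimilarLocallyAlgebraicWeilAnchorsAwayFromSplit 3 d) :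
    Summit.HodgeConjecture.HodgeConjecture.Theses.SplitImpliesAll.NonsplitSixfoldCells := by
  have hM : Literature.AlgebraicGeometry.HodgeTheory.Markman2025_weilClasses_algebraic_hyperbolicSixfold :=
    Summit.HodgeConjecture.HodgeConjecture.Ring2.Hypotheses.hyperbolicSixfolds_of_split_components_holds h₁
  have hW : Summit.HodgeConjecture.HodgeConjecture.Theses.SevenfoldWeilCensus.WeilSixfolds :=
    Summit.HodgeConjecture.HodgeConjecture.WeilTypeLadder.weilSixfolds_of_forall_slice fun d hd =>
      Summit.HodgeConjecture.HodgeConjecture.WeilTypeLadder.weilSixfolds_slice_of_floorAt_of_reachSimilar_of_similarAnchorsAwayFromSplit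
        d hd (Summit.HodgeConjecture.HodgeConjecture.WeilTypeLadder.floorAt_of_markman2025 hM d hd) h₂ (h₃ d hd)
  intro d hd δ _ _
  exact Summit.HodgeConjecture.HodgeConjecture.Ring2.AbelianAll.weilVariationalHodgeComponent_of_weilClassesComponent
    (Summit.HodgeConjecture.HodgeConjecture.Ring2.Hypotheses.weilClassesComponent_three_of_weilSixfolds hW hd δ)

theorem NonsplitSixfoldCells_holds_of_stubs :
    Summit.HodgeConjecture.HodgeConjecture.Theses.SplitImpliesAll.NonsplitSixfoldCells :=
  NonsplitSixfoldCells_of stub_splitFloor stub_reachSimilar stub_similarGermAnchors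

end Summit.HodgeConjecture.HodgeConjecture.Cruxes.NonsplitSixfoldCells.SimilarGermAnchors
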